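import Mathlib
import HarnessLib
import Summits.MatrixMultiplication.MatrixMultiplication.Theses.OutsiderSandwich
import Literature.Computability.AlgebraicComplexity.StrassenPreorder
import Literature.Computability.AlgebraicComplexity.TensorSemiringSpectrum
import Summits.MatrixMultiplication.MatrixMultiplication.Theorems.OutsiderSandwichLaserFloorTop
import Summits.MatrixMultiplication.MatrixMultiplication.Theorems.OutsiderSandwichSpectralConverse

/-!
# OutsiderSandwich — touching points: the two cruxes of the cut as statements about ONE spectral point

Route `route-MatrixMultiplication-OutsiderSandwich`, cut of record
`closes (h₁ : LaserTangency) (h₂ : LaserMergeOptimal) (h₃ : SummitIffLaserTangency)`; g11/g13 made both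
cruxes exact `ω`-free spectral letters (`laserTangency_iff_strict`, `laserMergeOptimal_iff_tightAtTop`).
This file is the lens-4 («minimal counterexample / extremal reduction») NORMAL FORM of those letters.
Write `τ_F = log₂ F⟨2,2,2⟩`, `x_F = log₂ F(cw₂)` for a universal spectral point `F`, and
`Λ(τ) = log₂ 3 + (τ - 2)/3` for the laser floor (`laserFloor`: `x_F ≥ Λ(τ_F)` always).  A universal
point with `x_F = Λ(τ_F)` is a **touching point**.  Using COMPACTNESS of the asymptotic spectrum
(Strassen 1988 Thm. 2.3 / Zuiddam 2018 Thm. 2.15; here `isCompact_spectrum_tensorClass` for `T(ℂ)`,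
the general form being the tree's `IsStrassenPreorder.isCompact_setOf_isSpectralPoint`; transported to
universal points via `TensorClass.isStrassenPreorder`, `TensorClass.isSpectralPoint_eval`,
`TensorClass.isUniversalSpectralPoint_spectralMapOf`) the `δ`-quantifiers of the letters are
eliminated — a sequence of almost-touching universal points has a cluster point in the spectrum, and
closed coordinate conditions pass to it (`le_of_mapClusterPt`, `exists_touching_of_seq`):

* `laserFloorStrict_iff_offCorner` : `LaserFloorStrict ⟺ ∀ F universal, 2 < τ_F → Λ(τ_F) < x_F`
  — no touching point off the corner `τ = 2`;  hence (`laserTangency_iff_offCorner`)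
  **`LaserTangency ⟺` the open floor segment `{(τ, Λ(τ)) : τ > 2}` carries no spectral point**.
* `laserTightAtTop_iff_corner` : `LaserTightAtTop ⟺ ∃ F universal, τ_F = ω ∧ x_F = Λ(ω)` — the top
  corner `(ω, Λ(ω))` of the floor IS a spectral point;  hence (`laserMergeOptimal_iff_corner`)
  **`LaserMergeOptimal ⟺ (ω, log₂ 3 + (ω-2)/3) ∈` the `(⟨2,2,2⟩, cw₂)`-shadow of the spectrum**.

So a counterexample to either crux is ONE universal spectral point in normal form (a touching point with
`τ > 2`, resp. every top point strictly above the floor), and (`summit_iff_corner_offCorner`)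
`ω = 2 ⟺` [the corner `(ω, Λ(ω))` is a spectral point] ∧ [no spectral point lies on the floor at `τ > 2`].

References: Strassen, Crelle 384 (1988) Thm. 2.3–2.4, Crelle 413 (1991) Thm. 6.7; Coppersmith–Winograd,
JSC 9 (1990) §6; Zuiddam, PhD thesis (2018) §2.
-/

-- the problem's namespace `Summit.MatrixMultiplication.MatrixMultiplication` repeats the summit name
set_option linter.dupNamespace false

namespace Summit.MatrixMultiplication.MatrixMultiplication.Theorems.OutsiderSandwichTouchingPoints

open scoped Topology
open Filter
open Literature.Computability.AlgebraicComplexity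
open Summit.MatrixMultiplication.MatrixMultiplication.Theses.OutsiderSandwich
open Summit.MatrixMultiplication.MatrixMultiplication.Theorems.OutsiderSandwichLaserFloor
  (one_le_map_matMulTensor two_le_matExp laserFloor)
open Summit.MatrixMultiplication.MatrixMultiplication.Theorems.OutsiderSandwichLaserFloorCut
  (three_le_map_cwTensor matExp_le_omega)
open Summit.MatrixMultiplication.MatrixMultiplication.Theorems.OutsiderSandwichLaserFloorTop
  (exists_top_point summitIffLaserFloor_holds)
open Summit.MatrixMultiplication.MatrixMultiplication.Theorems.OutsiderSandwichSpectralConverse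
  (laserTangency_iff_strict laserMergeOptimal_iff_tightAtTop)

/-! ## Cluster points of sequences of spectral points (compactness of the spectrum) -/

/-- A cluster point of a sequence lies in every closed set containing a tail of it. [folklore] -/
theorem mem_of_mapClusterPt {X : Type*} [TopologicalSpace X] {u : ℕ → X} {x : X}
    (hx : MapClusterPt x atTop u) {C : Set X} (hC : IsClosed C) (huC : ∀ᶠ n in atTop, u n ∈ C) :
    x ∈ C := by
  have hle : map u atTop ≤ 𝓟 C := le_principal_iff.2 (mem_map.2 huC)
  exact isClosed_iff_clusterPt.1 hC x (ClusterPt.mono hx hle)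

/-- A bound `f(u n) ≤ g(u n) + 1/(n+1)` along a sequence, with `f, g` continuous on a closed set
`D` containing the sequence, passes to the limit `f x ≤ g x` at a cluster point `x`. [folklore] -/
theorem le_of_mapClusterPt {X : Type*} [TopologicalSpace X] {u : ℕ → X} {x : X}
    (hx : MapClusterPt x atTop u) {D : Set X} (hD : IsClosed D) (huD : ∀ n, u n ∈ D)
    {f g : X → ℝ} (hf : ContinuousOn f D) (hg : ContinuousOn g D)
    (hfg : ∀ n : ℕ, f (u n) ≤ g (u n) + 1 / ((n : ℝ) + 1)) : f x ≤ g x := by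
  -- for every `m`, `x` lies in the closed set `D ∩ {f - g ≤ 1/(m+1)}`
  have hm : ∀ m : ℕ, f x ≤ g x + 1 / ((m : ℝ) + 1) := by
    intro m
    have hC : IsClosed (D ∩ (fun y => f y - g y) ⁻¹' Set.Iic (1 / ((m : ℝ) + 1))) :=
      (hf.sub hg).preimage_isClosed_of_isClosed hD isClosed_Iic
    have huC : ∀ᶠ n in atTop, u n ∈ D ∩ (fun y => f y - g y) ⁻¹' Set.Iic (1 / ((m : ℝ) + 1)) := by
      refine (eventually_ge_atTop m).mono fun n hn => ⟨huD n, ?_⟩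
      have h1 : 1 / ((n : ℝ) + 1) ≤ 1 / ((m : ℝ) + 1) :=
        one_div_le_one_div_of_le (by positivity) (by exact_mod_cast Nat.succ_le_succ hn)
      simp only [Set.mem_preimage, Set.mem_Iic]
      linarith [hfg n]
    have := (mem_of_mapClusterPt hx hC huC).2
    simp only [Set.mem_preimage, Set.mem_Iic] at this
    linarith
  refine le_of_forall_pos_lt_add fun ε hε => ?_
  obtain ⟨m, hm'⟩ := exists_nat_one_div_lt hε
  linarith [hm m]

/-- **The asymptotic spectrum of the tensor semiring `T(ℂ)` is compact** in the topology of
pointwise convergence: a closed subset (every axiom of a spectral point is an equation or inequality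
between finitely many coordinates) of the Tychonoff box `∏_a [0, R(a)]` (`IsSpectralPoint.nonneg`,
`IsSpectralPoint.le_rankOf`).  The statement for an arbitrary Strassen preorder is the tree's
`IsStrassenPreorder.isCompact_setOf_isSpectralPoint` (`Literature/…/StrassenPreorderSubrank.lean`);
the `T(ℂ)` case is proved here directly so that this file elaborates inside the OutsiderSandwich import
closure. [cite: Strassen1988, Thm. 2.3; Zuiddam2018, Thm. 2.15] -/
theorem isCompact_spectrum_tensorClass :
    IsCompact {φ : TensorClass ℂ → ℝ | IsSpectralPoint (fun x y : TensorClass ℂ => x ≤ y) φ} := by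
  have h := TensorClass.isStrassenPreorder ℂ
  have hbox : IsCompact (Set.pi Set.univ fun a : TensorClass ℂ => Set.Icc (0 : ℝ)
      (rankOf (fun x y : TensorClass ℂ => x ≤ y) a)) :=
    isCompact_univ_pi fun _ => isCompact_Icc
  refine hbox.of_isClosed_subset ?_ fun φ hφ a _ => ⟨hφ.nonneg h a, hφ.le_rankOf h a⟩
  have e : {φ : TensorClass ℂ → ℝ | IsSpectralPoint (fun x y : TensorClass ℂ => x ≤ y) φ} =
      {φ | φ 1 = 1} ∩ (⋂ a, ⋂ b, {φ : TensorClass ℂ → ℝ | φ (a + b) = φ a + φ b}) ∩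
        (⋂ a, ⋂ b, {φ : TensorClass ℂ → ℝ | φ (a * b) = φ a * φ b}) ∩
        (⋂ a, ⋂ b, ⋂ (_ : a ≤ b), {φ : TensorClass ℂ → ℝ | φ a ≤ φ b}) := by
    ext φ
    simp only [Set.mem_setOf_eq, Set.mem_inter_iff, Set.mem_iInter]
    exact ⟨fun hφ => ⟨⟨⟨hφ.map_one, hφ.map_add⟩, hφ.map_mul⟩, fun a b hab => hφ.mono hab⟩,
      fun ⟨⟨⟨h1, h2⟩, h3⟩, h4⟩ => ⟨h1, h2, h3, fun {a b} hab => h4 a b hab⟩⟩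
  rw [e]
  refine (IsClosed.inter (IsClosed.inter ?_ ?_) ?_).inter ?_
  · exact isClosed_eq (continuous_apply 1) continuous_const
  · exact isClosed_iInter fun a => isClosed_iInter fun b =>
      isClosed_eq (continuous_apply _) ((continuous_apply a).add (continuous_apply b))
  · exact isClosed_iInter fun a => isClosed_iInter fun b =>
      isClosed_eq (continuous_apply _) ((continuous_apply a).mul (continuous_apply b))
  · exact isClosed_iInter fun a => isClosed_iInter fun b => isClosed_iInter fun _ =>
      isClosed_le (continuous_apply a) (continuous_apply b)

/-- **Limit points of universal spectral points** (Strassen: `X` is compact): given universal spectral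
points `F n` over `ℂ`, there is a spectral point `φ` of the tensor semiring `T(ℂ)` which is a cluster
point of `n ↦ ([t] ↦ F n t)`, and `spectralMapOf φ` is a universal spectral point (with
`spectralMapOf φ t = φ [t]`, `TensorClass.spectralMapOf_apply`). [cite: Strassen1988, Thm. 2.3] -/
theorem exists_universal_clusterPt (F : ℕ → SpectralMap ℂ)
    (hF : ∀ n, IsUniversalSpectralPoint ℂ (F n)) :
    ∃ φ : TensorClass ℂ → ℝ, IsSpectralPoint (fun x y : TensorClass ℂ => x ≤ y) φ ∧
      MapClusterPt φ atTop (fun n => TensorClass.eval (F n)) ∧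
      IsUniversalSpectralPoint ℂ (TensorClass.spectralMapOf φ) := by
  have hK := isCompact_spectrum_tensorClass
  have hle : map (fun n => TensorClass.eval (F n)) atTop ≤
      𝓟 {φ : TensorClass ℂ → ℝ | IsSpectralPoint (fun x y : TensorClass ℂ => x ≤ y) φ} :=
    le_principal_iff.2 (mem_map.2 (Eventually.of_forall fun n => TensorClass.isSpectralPoint_eval (hF n)))
  obtain ⟨φ, hφ, hc⟩ := hK hle
  exact ⟨φ, hφ, hc, TensorClass.isUniversalSpectralPoint_spectralMapOf hφ⟩

/-! ## Coordinates on `T(ℂ) → ℝ` -/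

/-- The class `[⟨2,2,2⟩] ∈ T(ℂ)`. -/
private noncomputable abbrev aMM : TensorClass ℂ := TensorClass.mk (matMulTensor ℂ 2 2 2)
/-- The class `[cw₂] ∈ T(ℂ)`. -/
private noncomputable abbrev aCW : TensorClass ℂ := TensorClass.mk (cwTensor ℂ 2)

/-- The closed region `D = {ψ | 1 ≤ ψ[⟨2,2,2⟩], 3 ≤ ψ[cw₂]}` (contains every universal point). -/
private def regionD : Set (TensorClass ℂ → ℝ) := {ψ | 1 ≤ ψ aMM ∧ 3 ≤ ψ aCW}

/-- `D` is closed. -/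
private theorem isClosed_regionD : IsClosed regionD :=
  (isClosed_le continuous_const (continuous_apply aMM)).inter
    (isClosed_le continuous_const (continuous_apply aCW))

/-- Every universal point lies in `D` (`F⟨2,2,2⟩ ≥ 1`, `F(cw₂) ≥ 3`). -/
private theorem eval_mem_regionD {F : SpectralMap ℂ} (hF : IsUniversalSpectralPoint ℂ F) :
    TensorClass.eval F ∈ regionD := by
  refine ⟨?_, ?_⟩
  · show 1 ≤ TensorClass.eval F (TensorClass.mk (matMulTensor ℂ 2 2 2))
    rw [TensorClass.eval_mk hF]
    exact one_le_map_matMulTensor hF (by norm_num)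
  · show 3 ≤ TensorClass.eval F (TensorClass.mk (cwTensor ℂ 2))
    rw [TensorClass.eval_mk hF]
    exact three_le_map_cwTensor hF

/-- `ψ ↦ log₂ ψ(a)` is continuous on any region where `ψ(a) > 0`. [folklore] -/
private theorem continuousOn_logb_apply (a : TensorClass ℂ) {D : Set (TensorClass ℂ → ℝ)}
    (hD : ∀ ψ ∈ D, 0 < ψ a) :
    ContinuousOn (fun ψ : TensorClass ℂ → ℝ => Real.logb 2 (ψ a)) D := by
  have h1 : ContinuousOn (fun ψ : TensorClass ℂ → ℝ => ψ a) D := (continuous_apply a).continuousOn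
  have h2 : ContinuousOn (fun ψ : TensorClass ℂ → ℝ => Real.log (ψ a)) D :=
    h1.log fun ψ hψ => (hD ψ hψ).ne'
  have e : (fun ψ : TensorClass ℂ → ℝ => Real.logb 2 (ψ a)) =
      fun ψ => Real.log (ψ a) / Real.log 2 := rfl
  rw [e]
  exact h2.div_const _

/-- `τ` is continuous on `D`. -/
private theorem continuousOn_tau : ContinuousOn (fun ψ : TensorClass ℂ → ℝ => Real.logb 2 (ψ aMM)) regionD :=
  continuousOn_logb_apply aMM fun _ hψ => lt_of_lt_of_le one_pos hψ.1

/-- `x` is continuous on `D`. -/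
private theorem continuousOn_x : ContinuousOn (fun ψ : TensorClass ℂ → ℝ => Real.logb 2 (ψ aCW)) regionD :=
  continuousOn_logb_apply aCW fun _ hψ => lt_of_lt_of_le (by norm_num) hψ.2

/-- `Λ(τ)` is continuous on `D`. -/
private theorem continuousOn_floor : ContinuousOn
    (fun ψ : TensorClass ℂ → ℝ => Real.logb 2 3 + (Real.logb 2 (ψ aMM) - 2) / 3) regionD :=
  continuousOn_const.add ((continuousOn_tau.sub continuousOn_const).div_const _)

/-! ## From a sequence of almost-touching universal points to a touching point -/

/-- **Compactness step.**  If for every `n` there is a universal spectral point `F n` with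
`x_{F n} ≤ Λ(τ_{F n}) + 1/(n+1)` and `c ≤ τ_{F n} + 1/(n+1)` for every `c` in a set `T` of test
values, then there is a universal spectral point `F` with `x_F = Λ(τ_F)` and `c ≤ τ_F` for all `c ∈ T`.
[cite: Strassen1988, Thm. 2.3] -/
theorem exists_touching_of_seq (T : Set ℝ) (F : ℕ → SpectralMap ℂ)
    (hF : ∀ n, IsUniversalSpectralPoint ℂ (F n))
    (hx : ∀ n, Real.logb 2 (F n (cwTensor ℂ 2)) ≤
      Real.logb 2 3 + (Real.logb 2 (F n (matMulTensor ℂ 2 2 2)) - 2) / 3 + 1 / ((n : ℝ) + 1))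
    (hT : ∀ c ∈ T, ∀ n, c ≤ Real.logb 2 (F n (matMulTensor ℂ 2 2 2)) + 1 / ((n : ℝ) + 1)) :
    ∃ G : SpectralMap ℂ, IsUniversalSpectralPoint ℂ G ∧
      Real.logb 2 (G (cwTensor ℂ 2)) = Real.logb 2 3 + (Real.logb 2 (G (matMulTensor ℂ 2 2 2)) - 2) / 3 ∧
      ∀ c ∈ T, c ≤ Real.logb 2 (G (matMulTensor ℂ 2 2 2)) := by
  obtain ⟨φ, _, hc, hU⟩ := exists_universal_clusterPt F hF
  have hD : ∀ n, (fun n => TensorClass.eval (F n)) n ∈ regionD := fun n => eval_mem_regionD (hF n)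
  have hmm : ∀ n, TensorClass.eval (F n) aMM = F n (matMulTensor ℂ 2 2 2) :=
    fun n => TensorClass.eval_mk (hF n) _
  have hcw : ∀ n, TensorClass.eval (F n) aCW = F n (cwTensor ℂ 2) :=
    fun n => TensorClass.eval_mk (hF n) _
  -- pass `x ≤ Λ(τ) + 1/(n+1)` to the limit
  have hxφ : Real.logb 2 (φ aCW) ≤ Real.logb 2 3 + (Real.logb 2 (φ aMM) - 2) / 3 := by
    refine le_of_mapClusterPt hc isClosed_regionD hD continuousOn_x continuousOn_floor ?_
    intro n
    simp only [hmm, hcw]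
    exact hx n
  -- pass `c ≤ τ + 1/(n+1)` to the limit
  have hTφ : ∀ c ∈ T, c ≤ Real.logb 2 (φ aMM) := by
    intro c hcT
    refine le_of_mapClusterPt hc isClosed_regionD hD continuousOn_const continuousOn_tau ?_
    intro n
    simp only [hmm]
    exact hT c hcT n
  -- the universal point `spectralMapOf φ` has the same coordinates
  have e1 : TensorClass.spectralMapOf φ (matMulTensor ℂ 2 2 2) = φ aMM :=
    TensorClass.spectralMapOf_apply φ _
  have e2 : TensorClass.spectralMapOf φ (cwTensor ℂ 2) = φ aCW :=
    TensorClass.spectralMapOf_apply φ _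
  refine ⟨TensorClass.spectralMapOf φ, hU, ?_, ?_⟩
  · rw [e1, e2]
    have hfl := laserFloor hU
    rw [e1, e2] at hfl
    exact le_antisymm hxφ hfl
  · intro c hcT
    rw [e1]
    exact hTφ c hcT

/-! ## `LaserFloorStrict`: no touching point off the corner -/

/-- A touching point with `τ > 2` violates `LaserFloorStrict`. -/
theorem not_strict_of_touching {F : SpectralMap ℂ} (hF : IsUniversalSpectralPoint ℂ F)
    (hτ : 2 < Real.logb 2 (F (matMulTensor ℂ 2 2 2)))
    (hx : Real.logb 2 (F (cwTensor ℂ 2)) = Real.logb 2 3 + (Real.logb 2 (F (matMulTensor ℂ 2 2 2)) - 2) / 3) :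
    ¬ LaserFloorStrict := by
  intro hS
  obtain ⟨δ, hδ, hSδ⟩ := hS (Real.logb 2 (F (matMulTensor ℂ 2 2 2)) - 2) (by linarith)
  have := hSδ F hF (by linarith)
  linarith

/-- **If `LaserFloorStrict` fails there is a touching point with `τ > 2`.** [cite: Strassen1988, Thm. 2.3] -/
theorem exists_touching_of_not_strict (h : ¬ LaserFloorStrict) :
    ∃ F : SpectralMap ℂ, IsUniversalSpectralPoint ℂ F ∧ 2 < Real.logb 2 (F (matMulTensor ℂ 2 2 2)) ∧
      Real.logb 2 (F (cwTensor ℂ 2)) = Real.logb 2 3 + (Real.logb 2 (F (matMulTensor ℂ 2 2 2)) - 2) / 3 := by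
  unfold LaserFloorStrict at h
  push Not at h
  obtain ⟨η, hη, hall⟩ := h
  have hseq : ∀ n : ℕ, ∃ F : SpectralMap ℂ, IsUniversalSpectralPoint ℂ F ∧
      2 + η ≤ Real.logb 2 (F (matMulTensor ℂ 2 2 2)) ∧
      Real.logb 2 (F (cwTensor ℂ 2)) <
        Real.logb 2 3 + (Real.logb 2 (F (matMulTensor ℂ 2 2 2)) - 2) / 3 + 1 / ((n : ℝ) + 1) :=
    fun n => hall (1 / ((n : ℝ) + 1)) (by positivity)
  choose F hF hτ hx using hseq
  obtain ⟨G, hG, hGx, hGT⟩ := exists_touching_of_seq {2 + η} F hF (fun n => (hx n).le)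
    (fun c hc n => by
      rw [Set.mem_singleton_iff] at hc
      subst hc
      have : (0 : ℝ) ≤ 1 / ((n : ℝ) + 1) := by positivity
      linarith [hτ n])
  exact ⟨G, hG, by linarith [hGT (2 + η) rfl], hGx⟩

/-- **`LaserFloorStrict ⟺` no universal spectral point touches the floor at `τ > 2`.**
[cite: Strassen1988, Thm. 2.3] -/
theorem laserFloorStrict_iff_offCorner :
    LaserFloorStrict ↔ ∀ F : SpectralMap ℂ, IsUniversalSpectralPoint ℂ F →
      2 < Real.logb 2 (F (matMulTensor ℂ 2 2 2)) →
      Real.logb 2 3 + (Real.logb 2 (F (matMulTensor ℂ 2 2 2)) - 2) / 3 < Real.logb 2 (F (cwTensor ℂ 2)) := by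
  constructor
  · intro hS F hF hτ
    rcases lt_or_ge (Real.logb 2 3 + (Real.logb 2 (F (matMulTensor ℂ 2 2 2)) - 2) / 3)
      (Real.logb 2 (F (cwTensor ℂ 2))) with hlt | hle
    · exact hlt
    · exact absurd hS (not_strict_of_touching hF hτ (le_antisymm hle (laserFloor hF)))
  · intro hall
    by_contra hS
    obtain ⟨F, hF, hτ, hx⟩ := exists_touching_of_not_strict hS
    have := hall F hF hτ
    linarith

/-- **Normal form of the attacked crux: `LaserTangency ⟺` the open floor segment
`{(τ, log₂ 3 + (τ-2)/3) : τ > 2}` carries no universal spectral point.**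
[cite: Strassen1988, Thm. 2.3; CoppersmithWinograd1990, §6] -/
theorem laserTangency_iff_offCorner :
    LaserTangency ↔ ∀ F : SpectralMap ℂ, IsUniversalSpectralPoint ℂ F →
      2 < Real.logb 2 (F (matMulTensor ℂ 2 2 2)) →
      Real.logb 2 3 + (Real.logb 2 (F (matMulTensor ℂ 2 2 2)) - 2) / 3 < Real.logb 2 (F (cwTensor ℂ 2)) :=
  laserTangency_iff_strict.trans laserFloorStrict_iff_offCorner

/-! ## `LaserTightAtTop`: the top corner of the floor is a spectral point -/

/-- A universal point is **top** iff its matrix exponent is `ω`. [cite: Strassen1988, Thm. 2.4] -/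
theorem top_iff_matExp_eq_omega {F : SpectralMap ℂ} (hF : IsUniversalSpectralPoint ℂ F) :
    (∀ G : SpectralMap ℂ, IsUniversalSpectralPoint ℂ G →
        Real.logb 2 (G (matMulTensor ℂ 2 2 2)) ≤ Real.logb 2 (F (matMulTensor ℂ 2 2 2))) ↔
      Real.logb 2 (F (matMulTensor ℂ 2 2 2)) = omega ℂ := by
  constructor
  · intro htop
    obtain ⟨G, hG, hGω⟩ := exists_top_point
    have h1 := htop G hG
    rw [hGω] at h1
    exact le_antisymm (matExp_le_omega hF) h1
  · intro hω G hG
    rw [hω]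
    exact matExp_le_omega hG

/-- A top touching point gives `LaserTightAtTop`. -/
theorem tightAtTop_of_corner {F : SpectralMap ℂ} (hF : IsUniversalSpectralPoint ℂ F)
    (hω : Real.logb 2 (F (matMulTensor ℂ 2 2 2)) = omega ℂ)
    (hx : Real.logb 2 (F (cwTensor ℂ 2)) = Real.logb 2 3 + (omega ℂ - 2) / 3) :
    LaserTightAtTop := by
  intro δ hδ
  refine ⟨F, hF, fun G hG => ?_, ?_⟩
  · rw [hω]
    linarith [matExp_le_omega hG]
  · rw [hx, hω]
    linarith

/-- **If `LaserTightAtTop` holds, the top corner `(ω, Λ(ω))` is a spectral point.** [cite: Strassen1988, Thm. 2.3] -/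
theorem exists_corner_of_tightAtTop (h : LaserTightAtTop) :
    ∃ F : SpectralMap ℂ, IsUniversalSpectralPoint ℂ F ∧
      Real.logb 2 (F (matMulTensor ℂ 2 2 2)) = omega ℂ ∧
      Real.logb 2 (F (cwTensor ℂ 2)) = Real.logb 2 3 + (omega ℂ - 2) / 3 := by
  have hseq : ∀ n : ℕ, ∃ F : SpectralMap ℂ, IsUniversalSpectralPoint ℂ F ∧
      (∀ G : SpectralMap ℂ, IsUniversalSpectralPoint ℂ G →
        Real.logb 2 (G (matMulTensor ℂ 2 2 2)) ≤ Real.logb 2 (F (matMulTensor ℂ 2 2 2)) + 1 / ((n : ℝ) + 1)) ∧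
      Real.logb 2 (F (cwTensor ℂ 2)) ≤
        Real.logb 2 3 + (Real.logb 2 (F (matMulTensor ℂ 2 2 2)) - 2) / 3 + 1 / ((n : ℝ) + 1) :=
    fun n => h (1 / ((n : ℝ) + 1)) (by positivity)
  choose F hF htop hx using hseq
  -- test values: the matrix exponents of all universal points
  obtain ⟨G, hG, hGx, hGT⟩ := exists_touching_of_seq
    {c | ∃ G : SpectralMap ℂ, IsUniversalSpectralPoint ℂ G ∧ c = Real.logb 2 (G (matMulTensor ℂ 2 2 2))}
    F hF hx (fun c hc n => by
      obtain ⟨G, hG, rfl⟩ := hc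
      exact htop n G hG)
  have hω : Real.logb 2 (G (matMulTensor ℂ 2 2 2)) = omega ℂ :=
    (top_iff_matExp_eq_omega hG).1 fun G' hG' => hGT _ ⟨G', hG', rfl⟩
  refine ⟨G, hG, hω, ?_⟩
  rw [hGx, hω]

/-- **`LaserTightAtTop ⟺` the top corner `(ω, log₂ 3 + (ω-2)/3)` of the floor is (the shadow of) a
universal spectral point.** [cite: Strassen1988, Thm. 2.3–2.4] -/
theorem laserTightAtTop_iff_corner :
    LaserTightAtTop ↔ ∃ F : SpectralMap ℂ, IsUniversalSpectralPoint ℂ F ∧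
      Real.logb 2 (F (matMulTensor ℂ 2 2 2)) = omega ℂ ∧
      Real.logb 2 (F (cwTensor ℂ 2)) = Real.logb 2 3 + (omega ℂ - 2) / 3 :=
  ⟨exists_corner_of_tightAtTop, fun ⟨_, hF, hω, hx⟩ => tightAtTop_of_corner hF hω hx⟩

/-- **Normal form of the residual crux: `LaserMergeOptimal ⟺` there is a universal spectral point
`F` with `log₂ F⟨2,2,2⟩ = ω` and `log₂ F(cw₂) = log₂ 3 + (ω - 2)/3`** (the CW value of `cw₂` is
realised by a top spectral point). [cite: Strassen1988, Thm. 2.3–2.4; CoppersmithWinograd1990, §6] -/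
theorem laserMergeOptimal_iff_corner :
    LaserMergeOptimal ↔ ∃ F : SpectralMap ℂ, IsUniversalSpectralPoint ℂ F ∧
      Real.logb 2 (F (matMulTensor ℂ 2 2 2)) = omega ℂ ∧
      Real.logb 2 (F (cwTensor ℂ 2)) = Real.logb 2 3 + (omega ℂ - 2) / 3 :=
  laserMergeOptimal_iff_tightAtTop.trans laserTightAtTop_iff_corner

/-- **Both letters at once** — the statement of the route's aside `LaserLettersArePoints`
(g13 part 3): `(LaserTangency ⟺ no touching point at τ > 2) ∧ (LaserMergeOptimal ⟺ the top corner
(ω, Λ(ω)) is a spectral point)`. [cite: Strassen1988, Thm. 2.3–2.4] -/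
theorem laserLettersArePoints :
    (LaserTangency ↔ ∀ F : SpectralMap ℂ, IsUniversalSpectralPoint ℂ F →
      2 < Real.logb 2 (F (matMulTensor ℂ 2 2 2)) →
      Real.logb 2 3 + (Real.logb 2 (F (matMulTensor ℂ 2 2 2)) - 2) / 3 < Real.logb 2 (F (cwTensor ℂ 2))) ∧
    (LaserMergeOptimal ↔ ∃ F : SpectralMap ℂ, IsUniversalSpectralPoint ℂ F ∧
      Real.logb 2 (F (matMulTensor ℂ 2 2 2)) = omega ℂ ∧
      Real.logb 2 (F (cwTensor ℂ 2)) = Real.logb 2 3 + (omega ℂ - 2) / 3) :=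
  ⟨laserTangency_iff_offCorner, laserMergeOptimal_iff_corner⟩

/-! ## The summit in touching-point normal form -/

/-- **`ω(ℂ) = 2 ⟺` [the corner `(ω, Λ(ω))` is a spectral point] ∧ [no spectral point touches the
floor at `τ > 2`]** — the minimal-counterexample normal form of the OutsiderSandwich cut: a
counterexample to the summit is either a touching universal point off the corner, or the absence of a
touching point at the top. [cite: Strassen1988, Thm. 2.3–2.4] -/
theorem summit_iff_corner_offCorner :
    _root_.MatrixMultiplication ↔
      (∃ F : SpectralMap ℂ, IsUniversalSpectralPoint ℂ F ∧
        Real.logb 2 (F (matMulTensor ℂ 2 2 2)) = omega ℂ ∧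
        Real.logb 2 (F (cwTensor ℂ 2)) = Real.logb 2 3 + (omega ℂ - 2) / 3) ∧
      (∀ F : SpectralMap ℂ, IsUniversalSpectralPoint ℂ F →
        2 < Real.logb 2 (F (matMulTensor ℂ 2 2 2)) →
        Real.logb 2 3 + (Real.logb 2 (F (matMulTensor ℂ 2 2 2)) - 2) / 3 < Real.logb 2 (F (cwTensor ℂ 2))) := by
  have h : _root_.MatrixMultiplication ↔ LaserFloorStrict ∧ LaserTightAtTop := summitIffLaserFloor_holds
  rw [h, laserFloorStrict_iff_offCorner, laserTightAtTop_iff_corner]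
  exact and_comm

end Summit.MatrixMultiplication.MatrixMultiplication.Theorems.OutsiderSandwichTouchingPoints
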